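/-
Copyright (c) 2026. All rights reserved.
Released under Apache 2.0 license as described in the file LICENSE.
Authors: abc-iut cell, cone prover seat abc-iut-w6-d031 (gen 4; UNIF Tier-2 brick P7 «uniformised-base
junction»: a Riemann surface holomorphically covered by `ℍ` IS an `ℍ/Λ̄` of `HolRS`).
-/
import Mathlib.Topology.Homotopy.Lifting
import Literature.AnabelianGeometry.AbsoluteAnabelian.ArchimedeanHolFieldFunctorGeometricPSL
import Literature.AnabelianGeometry.AbsoluteAnabelian.ArchimedeanHolFieldFunctorGeometricCovers
import Literature.AnabelianGeometry.AbsoluteAnabelian.UniformizedCoverLiftPSL2R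
import Literature.AnabelianGeometry.AbsoluteAnabelian.HolomorphicCoresProofs
import Literature.AnabelianGeometry.AbsoluteAnabelian.AutHolomorphicSpacesCayleyProofs
import Literature.AnabelianGeometry.AbsoluteAnabelian.HyperbolicCoverOfNonabelianFundamentalGroupSecondCountable
import Literature.AnabelianGeometry.AbsoluteAnabelian.PuncturedEllipticCurveUniversalCoverHolds
import Literature.Topology.CoveringSpaces.CoveringDeckGroupAction
import Literature.Topology.CoveringSpaces.CoveringPreimageComponent
import Literature.Geometry.Manifold.QuotientMaps
import HarnessLib

/-!
# A Riemann surface holomorphically covered by `ℍ` is an `ℍ/Λ̄`, `Λ̄ ≤ PSL₂(ℝ)` (PROOF-ONLY)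

Topic `Literature/AnabelianGeometry/AbsoluteAnabelian`; campaign-L support for the geometric column of
[AbsTopIII] Prop 4.2 (i) / Cor 4.5 (S. Mochizuki, *Topics in absolute anabelian geometry III*, proof of
Prop 4.2 (i), kurims p.106 l.11–19: «the full subcategory of `EA` consisting of objects that map to `X`
may … be identified with the category of finite étale R-localizations `Loc_R(X)`») and for the
universal-covering clauses of [AbsTopIII] Cor 2.4 (p.54: «Let `X` be a hyperbolic Riemann surface of
finite type; `U^top → X^top` its universal covering»).  Classical source: H. M. Farkas, I. Kra,
*Riemann Surfaces* (2nd ed. 1992) IV.5.5–IV.5.6 («`M = M̃/G` … the covering group `G` is a group of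
conformal automorphisms of `M̃` … `Aut U ≅ PSL(2, ℝ)`»).

The tree's geometric model of `EA` (abc-iut-L4-t14, files `ArchimedeanHolFieldFunctorGeometricPSL*`) is
stated at the UNIFORMISED objects `HolRS.pslQuotient Λ̄ = ℍ/Λ̄` for torsion-free Fuchsian groups
`Λ̄ ≤ PSL₂(ℝ)` (acting freely and properly discontinuously); its fullness / faithfulness / rigidity
theorems carry the hypothesis that the base object IS such a quotient.  This file supplies the missing
JUNCTION with genuine Riemann surfaces (L4-t14 gen-4 HANDOFF residual «EA beyond one `X₀`
(uniformisation) … concrete `X₀` need uniformisation»):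

* ★ `HolRS.exists_pslQuotient_iso_of_cover` — **UNCONDITIONAL core**: for ANY object `X` of `HolRS`
  (connected Hausdorff Riemann surface) and ANY holomorphic covering map `k : ℍ → X`, the Möbius deck
  group `Λ̄ = {q ∈ PSL₂(ℝ) | k ∘ (q • ·) = k}` acts freely and properly discontinuously on `ℍ`, `k` is the
  quotient covering map for `Λ̄` (Mathlib `IsQuotientCoveringMap k Λ̄`), and `k` descends to an
  ISOMORPHISM `pslQuotient Λ̄ ≅ X` of `HolRS` (`[τ] ↦ k τ`); moreover `π₁(X, x) ≃* Λ̄` for every `x`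
  (`HolRS.exists_pslQuotient_iso_of_cover_pi1`).  Ingredients BY NAME: abc-iut-w5-d208's Möbius lifting
  `UniformizedLift.exists_sl_lift` (deck transformations of a holomorphic `ℍ`-covering are Möbius —
  transitivity of `Λ̄` on the fibres), `finite_deck_inter_of_isCompact` (deck groups act properly
  discontinuously), `CoverDeck.isQuotientCoveringMap_of_smul` (Hatcher 1.40), descent of holomorphy
  along `ℍ → ℍ/Λ̄` (`QuotientManifold.mdifferentiable_comp_mk_iff`) and abc-iut-L4-t12's
  `HolRS.isoOfHomeomorphOver`.
* `HolRS.exists_pslQuotient_iso_of_disc_cover` — the same from a holomorphic covering by the unit disc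
  (the tree's Cayley transform `exists_cayley`).
* UNCONDITIONAL genuine instances (Tier 1 of the cell's uniformization programme, all inputs landed):
  `HolRS.exists_pslQuotient_iso_of_isPuncturedEllipticCurve` — **every once-punctured elliptic curve
  (typed `IsPuncturedEllipticCurve`, the curves `X_K` at archimedean places) is an `ℍ/Λ̄` in `HolRS`**;
  `HolRS.exists_pslQuotient_iso_of_biholomorphic_torus_minus_finite` — every Riemann surface
  biholomorphic to a compact genus-one surface minus a non-empty finite set (type `(1, r)`).
* `HolRS.exists_pslQuotient_iso_of_nonabelian_fundamentalGroup` — **modulo the ONE Tier-2 named fact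
  `RiemannSurface.SimplyConnectedUniformization`**: every connected second-countable Riemann surface
  with non-abelian fundamental group (every hyperbolic Riemann surface of finite type, in particular
  compact genus `≥ 2`) is an `ℍ/Λ̄` in `HolRS`, with `Λ̄ ≃* π₁`.

Everything is a theorem; no definition, no instance, no named fact.  HONEST FRAMING: classical
covering-space theory and the tree's `Aut(ℍ) = PSL₂(ℝ)`; MODEL ≠ reconstruction; nothing here bears on
the disputed [IUTchIII] Cor. 3.12; typed ≠ proved elsewhere.

## References

* S. Mochizuki, *Topics in Absolute Anabelian Geometry III*, J. Math. Sci. Univ. Tokyo 22 (2015),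
  proof of Prop. 4.2 (i) p.106; Cor. 2.4 p.54. [MochizukiAbsTopIII2015]
* H. M. Farkas, I. Kra, *Riemann Surfaces*, 2nd ed., GTM 71 (1992), IV.5.5–IV.5.6, IV.6.1, IV.6.4.
  [FarkasKra1992]
* A. Hatcher, *Algebraic Topology* (2002), §1.3 Prop. 1.39–1.40. [HatcherAT2002]
-/

set_option autoImplicit false

noncomputable section

namespace Literature.AnabelianGeometry.AbsoluteAnabelian

namespace HolRS

open scoped _root_.Manifold _root_.ContDiff _root_.Topology MatrixGroups UpperHalfPlane
open _root_.MulAction _root_.Function _root_.Set _root_.CategoryTheory _root_.TopologicalSpace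
open Literature.Topology.CoveringSpaces Literature.Geometry.Manifold
open Literature.Geometry.Kaehler.ComplexTorus (deckTransformations mem_deckTransformations_iff)

/-! ### §1 The unconditional core: a holomorphic `ℍ`-covering presents `X` as `ℍ/Λ̄` -/

section Core

variable (X : HolRS) {k : ℍ → X.carrier}

/-- **A Riemann surface holomorphically covered by the upper half plane is an `ℍ/Λ̄`** (Farkas–Kra
IV.5.5–IV.5.6: `M = M̃/G`, the covering group acting by conformal automorphisms of `M̃ = U`,
`Aut U ≅ PSL(2, ℝ)`): for `X ∈ HolRS` and a holomorphic covering map `k : ℍ → X`, the Möbius deck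
group `Λ̄ = {q ∈ PSL₂(ℝ) | k (q • τ) = k τ ∀ τ}` — given here by its membership criterion — acts on `ℍ`
properly discontinuously and freely, its orbits are exactly the fibres of `k`, `k` is the quotient
covering map for `Λ̄`, and `k` descends to an ISOMORPHISM `pslQuotient Λ̄ ≅ X` of `HolRS`,
`[τ]_Λ̄ ↦ k τ`.  This is the junction that puts a genuine `X` at the base `X₀ = ℍ/Γ̄` of the tree's
geometric `EA`/`Loc(PSL₂(ℝ), Γ̄)` column. [cite: FarkasKra1992, IV.5.5–IV.5.6]
[cite: MochizukiAbsTopIII2015, Proposition 4.2 (i) proof p.106] -/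
theorem exists_pslQuotient_iso_of_cover (hk : IsCoveringMap k)
    (dk : MDifferentiable 𝓘(ℂ, ℂ) 𝓘(ℂ, ℂ) k) :
    ∃ (Λ : Subgroup PSL2R) (_ : ProperlyDiscontinuousSMul Λ ℍ) (_ : IsCancelSMul Λ ℍ),
      (∀ q : PSL2R, q ∈ Λ ↔ ∀ τ : ℍ, k (q • τ) = k τ) ∧
      (∀ τ τ' : ℍ, k τ = k τ' ↔ ∃ q ∈ Λ, q • τ = τ') ∧
      IsQuotientCoveringMap k Λ ∧
      ∃ e : pslQuotient Λ ≅ X, ∀ τ : ℍ, e.hom.toFun (Quotient.mk (orbitRel Λ ℍ) τ) = k τ := by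
  -- the Möbius deck group
  let Λ : Subgroup PSL2R :=
    { carrier := {q | ∀ τ : ℍ, k (q • τ) = k τ}
      mul_mem' := fun {a b} ha hb τ => by
        show k ((a * b) • τ) = k τ
        rw [mul_smul, ha, hb]
      one_mem' := fun τ => by
        show k ((1 : PSL2R) • τ) = k τ
        rw [one_smul]
      inv_mem' := fun {a} ha τ => by
        show k (a⁻¹ • τ) = k τ
        conv_rhs => rw [← smul_inv_smul a τ]
        exact (ha _).symm }
  have hΛ : ∀ q : PSL2R, q ∈ Λ ↔ ∀ τ : ℍ, k (q • τ) = k τ := fun q => Iff.rfl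
  -- `k` is onto (connected base, non-empty total space)
  have hsurj : Surjective k := hk.surjective_of_connectedSpace'
  -- deck transformations of the holomorphic `ℍ`-covering are Möbius: `Λ̄` is transitive on the fibres
  have hid : IsCoveringMap (fun x : X.carrier => x) := IsFiniteEtale.id.isCoveringMap
  have htrans : ∀ τ τ' : ℍ, k τ = k τ' → ∃ q ∈ Λ, q • τ = τ' := by
    intro τ τ' h
    obtain ⟨γ, hγ, hγτ⟩ :=
      UniformizedLift.exists_sl_lift (π₁ := k) (π₂ := k) (h := fun x : X.carrier => x) hk hk hid dk dk
        mdifferentiable_id (e₁ := τ) (e₂ := τ') h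
    refine ⟨(QuotientGroup.mk γ : PSL2R), fun σ => ?_, ?_⟩
    · rw [psl_mk_smul]; exact hγ σ
    · rw [psl_mk_smul]; exact hγτ
  have hfib : ∀ τ τ' : ℍ, k τ = k τ' ↔ ∃ q ∈ Λ, q • τ = τ' := fun τ τ' =>
    ⟨htrans τ τ', by rintro ⟨q, hq, rfl⟩; exact ((hΛ q).1 hq τ).symm⟩
  -- the action of `Λ̄`: continuous, faithful; `k` is its quotient covering map (Hatcher 1.40)
  haveI : ContinuousConstSMul Λ ℍ := ⟨fun q => continuous_const_smul (q : PSL2R)⟩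
  haveI : FaithfulSMul Λ ℍ := ⟨fun {a b} h => by
    apply Subtype.ext
    have h1 : ((a : PSL2R)⁻¹ * (b : PSL2R)) = 1 := by
      refine psl_eq_one_of_forall_smul_eq fun τ => ?_
      rw [mul_smul, inv_smul_eq_iff]
      exact (h τ).symm
    exact (inv_mul_eq_one.mp h1)⟩
  have hq : IsQuotientCoveringMap k Λ :=
    CoverDeck.isQuotientCoveringMap_of_smul hk hsurj (fun g τ => (hΛ (g : PSL2R)).1 g.2 τ)
      (fun τ₁ τ₂ h => by
        obtain ⟨q, hqΛ, hqτ⟩ := htrans τ₂ τ₁ h.symm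
        exact ⟨⟨q, hqΛ⟩, hqτ⟩)
  haveI hC : IsCancelSMul Λ ℍ := hq.isCancelSMul
  -- proper discontinuity: inject into the finitely many deck homeomorphisms meeting `K`, `L`
  haveI : LocallyConnectedSpace X.carrier := ChartedSpace.locallyConnectedSpace ℂ _
  haveI hPD : ProperlyDiscontinuousSMul Λ ℍ := ⟨fun {K L} hK hL => by
    let φ : Λ → (ℍ ≃ₜ ℍ) := fun q => Homeomorph.smul (q : PSL2R)
    have hφ : Injective φ := by
      intro a b hab
      apply Subtype.ext
      have h1 : ((a : PSL2R)⁻¹ * (b : PSL2R)) = 1 := by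
        refine psl_eq_one_of_forall_smul_eq fun τ => ?_
        rw [mul_smul, inv_smul_eq_iff]
        have := congrArg (fun ψ : ℍ ≃ₜ ℍ => ψ τ) hab
        exact this.symm
      exact inv_mul_eq_one.mp h1
    have hfin := finite_deck_inter_of_isCompact hk hK hL
    have hsub : {γ : Λ | ((γ • ·) '' K ∩ L).Nonempty} ⊆
        φ ⁻¹' {γ : ℍ ≃ₜ ℍ | γ ∈ deckTransformations k ∧ (γ '' K ∩ L).Nonempty} := by
      intro q hq
      exact ⟨(mem_deckTransformations_iff k _).2 ((hΛ (q : PSL2R)).1 q.2), hq⟩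
    exact (hfin.preimage hφ.injOn).subset hsub⟩
  -- `k` descends to a continuous open bijection `ℍ/Λ̄ → X`
  have hresp : ∀ a b : ℍ, (orbitRel Λ ℍ) a b → k a = k b := by
    intro a b hab
    rw [orbitRel_apply, mem_orbit_iff] at hab
    obtain ⟨g, rfl⟩ := hab
    exact (hΛ (g : PSL2R)).1 g.2 b
  let kbar : orbitRel.Quotient Λ ℍ → X.carrier := Quotient.lift k hresp
  have hkbar : ∀ τ, kbar (Quotient.mk _ τ) = k τ := fun τ => rfl
  have hkbar_cont : Continuous kbar := hk.continuous.quotient_lift hresp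
  have hkbar_bij : Bijective kbar := by
    refine ⟨fun a b hab => ?_, fun x => ?_⟩
    · induction a using Quotient.inductionOn with | h a => ?_
      induction b using Quotient.inductionOn with | h b => ?_
      change k a = k b at hab
      obtain ⟨q, hqΛ, rfl⟩ := (hfib a b).1 hab
      refine Quotient.sound ?_
      change a ∈ orbit (↥Λ) (q • a)
      rw [mem_orbit_iff]
      refine ⟨⟨q⁻¹, Λ.inv_mem hqΛ⟩, ?_⟩
      show (q⁻¹ : PSL2R) • q • a = a
      rw [inv_smul_smul]
    · obtain ⟨τ, rfl⟩ := hsurj x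
      exact ⟨Quotient.mk _ τ, rfl⟩
  have hkbar_open : IsOpenMap kbar := by
    intro V hV
    have : kbar '' V = k '' (Quotient.mk (orbitRel Λ ℍ) ⁻¹' V) := by
      ext y
      constructor
      · rintro ⟨q, hqV, rfl⟩
        induction q using Quotient.inductionOn with | h m => exact ⟨m, hqV, rfl⟩
      · rintro ⟨m, hm, rfl⟩
        exact ⟨Quotient.mk _ m, hm, rfl⟩
    rw [this]
    exact hk.isLocalHomeomorph.isOpenMap _ (hV.preimage continuous_quot_mk)
  let e : (pslQuotient Λ).carrier ≃ₜ X.carrier :=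
    (Equiv.ofBijective kbar hkbar_bij).toHomeomorphOfContinuousOpen hkbar_cont hkbar_open
  have he : ∀ τ : ℍ, e (Quotient.mk (orbitRel Λ ℍ) τ) = k τ := fun τ => rfl
  -- holomorphy of the descended map, by descent along `ℍ → ℍ/Λ̄`
  have hsmoothΛ : ∀ g : Λ, ContMDiff 𝓘(ℂ, ℂ) 𝓘(ℂ, ℂ) ω (fun x : ℍ => g • x) :=
    fun g => contMDiff_psl_smul (g : PSL2R)
  have hcomp : MDifferentiable 𝓘(ℂ, ℂ) 𝓘(ℂ, ℂ)
      ((⇑e : (pslQuotient Λ).carrier → X.carrier) ∘ QuotientManifold.mk (G := Λ) (M := ℍ)) := by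
    have : (⇑e : (pslQuotient Λ).carrier → X.carrier) ∘ QuotientManifold.mk (G := Λ) (M := ℍ) = k :=
      funext he
    rw [this]
    exact dk
  have de : MDifferentiable 𝓘(ℂ, ℂ) 𝓘(ℂ, ℂ) (⇑e : (pslQuotient Λ).carrier → X.carrier) :=
    (QuotientManifold.mdifferentiable_comp_mk_iff (G := Λ) (M := ℍ) (N := X.carrier) hsmoothΛ
      (by simp)).mp hcomp
  -- the isomorphism of `HolRS` (a homeomorphism over `X` between objects of `HolRS`)
  let ehom : pslQuotient Λ ⟶ X :=
    { toFun := e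
      mdifferentiable := de
      isFiniteEtale := IsFiniteEtale.of_homeomorph e }
  let iso : pslQuotient Λ ≅ X := isoOfHomeomorphOver ehom (𝟙 X) e (funext fun _ => rfl)
  exact ⟨Λ, hPD, hC, hΛ, hfib, hq, iso, fun τ => by
    rw [isoOfHomeomorphOver_hom_toFun]
    exact he τ⟩

/-- **… with `π₁(X) ≅ Λ̄`**: in the situation of `exists_pslQuotient_iso_of_cover`, the fundamental group
of `X` at any base point is isomorphic to the Möbius deck group `Λ̄` (Hatcher 1.40 (c) for the simply
connected cover `ℍ`, Mathlib `IsQuotientCoveringMap.fundamentalGroupEquiv`; Farkas–Kra IV.5.6 «the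
covering group of `M` is isomorphic to `π₁(M)`»). [cite: FarkasKra1992, IV.5.5–IV.5.6]
[cite: HatcherAT2002, §1.3 Prop. 1.40] -/
theorem exists_pslQuotient_iso_of_cover_pi1 (hk : IsCoveringMap k)
    (dk : MDifferentiable 𝓘(ℂ, ℂ) 𝓘(ℂ, ℂ) k) :
    ∃ (Λ : Subgroup PSL2R) (_ : ProperlyDiscontinuousSMul Λ ℍ) (_ : IsCancelSMul Λ ℍ),
      (∀ q : PSL2R, q ∈ Λ ↔ ∀ τ : ℍ, k (q • τ) = k τ) ∧
      (∀ x : X.carrier, Nonempty (FundamentalGroup X.carrier x ≃* Λ)) ∧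
      ∃ e : pslQuotient Λ ≅ X, ∀ τ : ℍ, e.hom.toFun (Quotient.mk (orbitRel Λ ℍ) τ) = k τ := by
  obtain ⟨Λ, hPD, hC, hΛ, -, hq, e, he⟩ := exists_pslQuotient_iso_of_cover X hk dk
  refine ⟨Λ, hPD, hC, hΛ, fun x => ?_, e, he⟩
  obtain ⟨τ, hτ⟩ := hq.surjective x
  exact ⟨(hq.fundamentalGroupEquiv ⟨τ, hτ⟩).trans (MulEquiv.inv' Λ).symm⟩

end Core

/-! ### §2 From a holomorphic covering by the unit disc (Cayley transform) -/

section Disc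

variable (X : HolRS)

/-- **A Riemann surface holomorphically covered by the unit disc is an `ℍ/Λ̄`**: transport along the
tree's biholomorphic Cayley transform `unitDiscOpens ≃ₜ ℍ` and apply `exists_pslQuotient_iso_of_cover`.
The output also records the holomorphic `ℍ`-covering `k = p ∘ C⁻¹` it uniformises by.
[cite: FarkasKra1992, IV.5.5–IV.5.6] [cite: MochizukiAbsTopIII2015, Corollary 2.4 p.54] -/
theorem exists_pslQuotient_iso_of_disc_cover {p : unitDiscOpens → X.carrier} (hp : IsCoveringMap p)
    (dp : MDifferentiable 𝓘(ℂ, ℂ) 𝓘(ℂ, ℂ) p) :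
    ∃ (k : ℍ → X.carrier) (Λ : Subgroup PSL2R) (_ : ProperlyDiscontinuousSMul Λ ℍ)
      (_ : IsCancelSMul Λ ℍ),
      IsCoveringMap k ∧ MDifferentiable 𝓘(ℂ, ℂ) 𝓘(ℂ, ℂ) k ∧ range k = range p ∧
      (∀ q : PSL2R, q ∈ Λ ↔ ∀ τ : ℍ, k (q • τ) = k τ) ∧
      IsQuotientCoveringMap k Λ ∧
      (∀ x : X.carrier, Nonempty (FundamentalGroup X.carrier x ≃* Λ)) ∧
      ∃ e : pslQuotient Λ ≅ X, ∀ τ : ℍ, e.hom.toFun (Quotient.mk (orbitRel Λ ℍ) τ) = k τ := by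
  obtain ⟨C, hC, hCs, -, -⟩ := exists_cayley
  let k : ℍ → X.carrier := p ∘ C.symm
  have hk : IsCoveringMap k := hp.comp_homeomorph C.symm
  have dk : MDifferentiable 𝓘(ℂ, ℂ) 𝓘(ℂ, ℂ) k := dp.comp hCs
  have hrange : range k = range p := by
    apply Set.ext
    intro x
    constructor
    · rintro ⟨τ, rfl⟩; exact ⟨C.symm τ, rfl⟩
    · rintro ⟨w, rfl⟩; exact ⟨C w, by show p (C.symm (C w)) = p w; rw [C.symm_apply_apply]⟩
  obtain ⟨Λ, hPD, hCan, hΛ, -, hq, e, he⟩ := exists_pslQuotient_iso_of_cover X hk dk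
  refine ⟨k, Λ, hPD, hCan, hk, dk, hrange, hΛ, hq, fun x => ?_, e, he⟩
  obtain ⟨τ, hτ⟩ := hq.surjective x
  exact ⟨(hq.fundamentalGroupEquiv ⟨τ, hτ⟩).trans (MulEquiv.inv' Λ).symm⟩

end Disc

/-! ### §3 Unconditional genuine instances: curves of type `(1, r)` -/

section Instances

variable (X : HolRS)

/-- **Every once-punctured elliptic curve is an `ℍ/Λ̄` in `HolRS`** — UNCONDITIONAL: the carrier of `X`
is a punctured elliptic curve in the typed conformal sense `IsPuncturedEllipticCurve` ([AbsTopIII]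
Def 2.1 (i) / Cor 2.7: the curves of type `(1,1)`), the disc covers it holomorphically
(`exists_disc_covering_of_isPuncturedEllipticCurve'`, Tier 1 of the cell's uniformization programme),
hence `X ≅ pslQuotient Λ̄` with `Λ̄ ≃* π₁(X)`. [cite: MochizukiAbsTopIII2015, Corollary 2.4 p.54]
[cite: FarkasKra1992, IV.6.4] -/
theorem exists_pslQuotient_iso_of_isPuncturedEllipticCurve
    (hX : TorsionPointsDenseUniqueGroupLaw.IsPuncturedEllipticCurve X.carrier) :
    ∃ (k : ℍ → X.carrier) (Λ : Subgroup PSL2R) (_ : ProperlyDiscontinuousSMul Λ ℍ)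
      (_ : IsCancelSMul Λ ℍ),
      IsCoveringMap k ∧ MDifferentiable 𝓘(ℂ, ℂ) 𝓘(ℂ, ℂ) k ∧
      (∀ q : PSL2R, q ∈ Λ ↔ ∀ τ : ℍ, k (q • τ) = k τ) ∧
      IsQuotientCoveringMap k Λ ∧
      (∀ x : X.carrier, Nonempty (FundamentalGroup X.carrier x ≃* Λ)) ∧
      ∃ e : pslQuotient Λ ≅ X, ∀ τ : ℍ, e.hom.toFun (Quotient.mk (orbitRel Λ ℍ) τ) = k τ := by
  obtain ⟨p, hp, -, dp⟩ :=
    HolomorphicEllipticCuspidalization.exists_disc_covering_of_isPuncturedEllipticCurve' X.carrier hX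
  obtain ⟨k, Λ, hPD, hC, hk, dk, -, hΛ, hq, hπ, e, he⟩ := exists_pslQuotient_iso_of_disc_cover X hp dp
  exact ⟨k, Λ, hPD, hC, hk, dk, hΛ, hq, hπ, e, he⟩

/-- **Every Riemann surface biholomorphic to a compact genus-one surface minus a non-empty finite set is
an `ℍ/Λ̄` in `HolRS`** (hyperbolic curves of type `(1, r)`, `r ≥ 1`) — UNCONDITIONAL, from the tree's
`RiemannSurface.exists_disc_covering_of_biholomorphic_torus_minus_finite'`.
[cite: FarkasKra1992, IV.6.4] -/
theorem exists_pslQuotient_iso_of_biholomorphic_torus_minus_finite {T : Type} [TopologicalSpace T]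
    [T2Space T] [CompactSpace T] [ConnectedSpace T] [ChartedSpace ℂ T] [IsManifold 𝓘(ℂ, ℂ) ω T]
    (e₀ : T ≃ₜ AddCircle (1 : ℝ) × AddCircle (1 : ℝ)) {S : Set T} (hS : S.Finite) (hne : S.Nonempty)
    (φ : X.carrier ≃ₜ (⟨Sᶜ, hS.isClosed.isOpen_compl⟩ : Opens T))
    (hφ : MDifferentiable 𝓘(ℂ, ℂ) 𝓘(ℂ, ℂ) φ.symm) :
    ∃ (k : ℍ → X.carrier) (Λ : Subgroup PSL2R) (_ : ProperlyDiscontinuousSMul Λ ℍ)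
      (_ : IsCancelSMul Λ ℍ),
      IsCoveringMap k ∧ MDifferentiable 𝓘(ℂ, ℂ) 𝓘(ℂ, ℂ) k ∧
      (∀ q : PSL2R, q ∈ Λ ↔ ∀ τ : ℍ, k (q • τ) = k τ) ∧
      IsQuotientCoveringMap k Λ ∧
      (∀ x : X.carrier, Nonempty (FundamentalGroup X.carrier x ≃* Λ)) ∧
      ∃ e : pslQuotient Λ ≅ X, ∀ τ : ℍ, e.hom.toFun (Quotient.mk (orbitRel Λ ℍ) τ) = k τ := by
  obtain ⟨p, hp, -, dp⟩ :=
    Literature.Geometry.Kaehler.RiemannSurface.exists_disc_covering_of_biholomorphic_torus_minus_finite'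
      e₀ hS hne φ hφ
  obtain ⟨k, Λ, hPD, hC, hk, dk, -, hΛ, hq, hπ, e, he⟩ := exists_pslQuotient_iso_of_disc_cover X hp dp
  exact ⟨k, Λ, hPD, hC, hk, dk, hΛ, hq, hπ, e, he⟩

end Instances

/-! ### §4 Modulo `SimplyConnectedUniformization`: every hyperbolic Riemann surface of finite type -/

section Conditional

variable (X : HolRS)

/-- **Modulo the uniformization of simply connected Riemann surfaces, every connected second countable
Riemann surface with NON-ABELIAN fundamental group is an `ℍ/Λ̄` in `HolRS`**, `Λ̄ ≃* π₁(X)` — every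
hyperbolic Riemann surface of finite type (`2g − 2 + r > 0`: `(0, r ≥ 3)`, `(1, r ≥ 1)`, all `g ≥ 2`
including COMPACT genus `≥ 2`), the objects [AbsTopIII] §2 and Def 4.1 are written for.  Conditional on
the ONE Tier-2 named fact `RiemannSurface.SimplyConnectedUniformization` through
`exists_disc_covering_of_nonabelian_fundamentalGroup'`. [cite: MochizukiAbsTopIII2015, Corollary 2.4 p.54]
[cite: FarkasKra1992, IV.5.5–IV.5.6] -/
theorem exists_pslQuotient_iso_of_nonabelian_fundamentalGroup
    (H2 : Literature.Geometry.Kaehler.RiemannSurface.SimplyConnectedUniformization)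
    [SecondCountableTopology X.carrier] (x₀ : X.carrier)
    (hπ : ∃ a b : FundamentalGroup X.carrier x₀, a * b ≠ b * a) :
    ∃ (k : ℍ → X.carrier) (Λ : Subgroup PSL2R) (_ : ProperlyDiscontinuousSMul Λ ℍ)
      (_ : IsCancelSMul Λ ℍ),
      IsCoveringMap k ∧ MDifferentiable 𝓘(ℂ, ℂ) 𝓘(ℂ, ℂ) k ∧
      (∀ q : PSL2R, q ∈ Λ ↔ ∀ τ : ℍ, k (q • τ) = k τ) ∧
      IsQuotientCoveringMap k Λ ∧
      (∀ x : X.carrier, Nonempty (FundamentalGroup X.carrier x ≃* Λ)) ∧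
      ∃ e : pslQuotient Λ ≅ X, ∀ τ : ℍ, e.hom.toFun (Quotient.mk (orbitRel Λ ℍ) τ) = k τ := by
  obtain ⟨p, hp, -, dp⟩ := exists_disc_covering_of_nonabelian_fundamentalGroup' H2 x₀ hπ
  obtain ⟨k, Λ, hPD, hC, hk, dk, -, hΛ, hq, hπ1, e, he⟩ := exists_pslQuotient_iso_of_disc_cover X hp dp
  exact ⟨k, Λ, hPD, hC, hk, dk, hΛ, hq, hπ1, e, he⟩

/-- **The Möbius deck group of a hyperbolic Riemann surface is non-abelian** when `π₁(X)` is: a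
sanity clause for consumers of the geometric column, which is stated for `Λ̄` free of rank `≥ 2` /
centraliser-free — here only the non-commutativity transported along `Λ̄ ≃* π₁(X)` is recorded.
[cite: FarkasKra1992, IV.5.5–IV.5.6] -/
theorem exists_pslQuotient_iso_nonabelian_of_nonabelian_fundamentalGroup
    (H2 : Literature.Geometry.Kaehler.RiemannSurface.SimplyConnectedUniformization)
    [SecondCountableTopology X.carrier] (x₀ : X.carrier)
    (hπ : ∃ a b : FundamentalGroup X.carrier x₀, a * b ≠ b * a) :
    ∃ (Λ : Subgroup PSL2R) (_ : ProperlyDiscontinuousSMul Λ ℍ) (_ : IsCancelSMul Λ ℍ),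
      (∃ a b : Λ, a * b ≠ b * a) ∧ Nonempty (pslQuotient Λ ≅ X) := by
  obtain ⟨k, Λ, hPD, hC, -, -, -, -, hiso, e, -⟩ :=
    exists_pslQuotient_iso_of_nonabelian_fundamentalGroup X H2 x₀ hπ
  obtain ⟨φ⟩ := hiso x₀
  obtain ⟨a, b, hab⟩ := hπ
  refine ⟨Λ, hPD, hC, ⟨φ a, φ b, fun h => hab ?_⟩, ⟨e⟩⟩
  apply φ.injective
  rw [map_mul, map_mul]
  exact h

end Conditional

end HolRS

end Literature.AnabelianGeometry.AbsoluteAnabelian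

end
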